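/-
Copyright (c) 2026 the pub-hodgecm-mathlib formalisation cell (harness21).  Prover seat hodgecm-mathlib-LH7-p08 (g0) (re-dealt to strike line L3 `stub_N6nsDyadic` by director
s1969 (a)), Track A «(D-RAM) FOUR-FRAME» squad, helper lane on h413 = stmt-HodgeConjecture-24833 (count-neutral).  β-BOARD v1 row R8 ∕ (P5) «H `(2ρ,2ρ,2ρ)`», FILE 4b′: the
ADDITIVE character sum over the admissible classes at the break, `Σ_{g adm} ω(1 + δg) = −q^{⌈ρ∕2⌉−1}·(1 + ω(1 − δ))`, `|δ| = |ϖ|^{2d−2}`.  2026-09-04.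
-/
import Summits.HodgeConjecture.HodgeConjecture.Theorems.F0P3cDyRamDiagonalKappaCoreHangingCharacterMaps   -- ★ κH (B1a) (LH4-p06 (g3)): `v_add_eq_one_of_lt`; brings the ★ ω-conductor toolkit (`exists_fixed_unit_not_norm_v_sub_one_le`, §3–§4)
import Summits.HodgeConjecture.HodgeConjecture.Theorems.F0P3cDyRamDiagonalCoreHangingClasses            -- ★ (B) (LH4-p08 (g3)): `ncard_bad_representatives_eq`
import Summits.HodgeConjecture.HodgeConjecture.Theorems.F0P3cDyRamDiagonalKappaCoreHangingClass          -- ★ κH-A2 (LH4-p06 (g3)): `two_le_d_of_v_two_lt_one`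
import Literature.NumberTheory.LocalFields.WildQuadraticDatumNormFibreValues                             -- ★ (LH4-p12 (g3)): `v_le_varpi_sq_of_fixed_of_lt_one` (a fixed scalar of `𝓂` lies in `𝓂²`)
import Summits.HodgeConjecture.HodgeConjecture.Theorems.F0P3cDyRamDiagonalGluedClassRepresentatives       -- ★ (iv-c) (LH4-p08 (g3)): `exists_fixed_class_representatives` (a full system, for §3)
import Mathlib.Algebra.BigOperators.Finprod
import Mathlib.Data.Set.Card
import HarnessLib

/-!
# Crux `H413`, line LH4 «(D-RAM) FOUR-FRAME» — (β) table, β-BOARD row R8 ∕ (P5), FILE 4b′: «THE ADDITIVE CHARACTER SUM OVER THE ADMISSIBLE CLASSES AT THE BREAK: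
# `Σ_{g ∈ R, |1+g| = 1} ω(1 + δg) = −q^{⌈ρ∕2⌉−1}·(1 + ω(1 − δ))` for `|δ| = |ϖ|^{2d−2}`»

Cell `hodgecm-mathlib` (D-0151), FLOOR 0, crux item H413 = `stmt-HodgeConjecture-24833`, route `HCCMUnconditional`; squad F0∕P3c∕LH4.  THEOREMS ONLY (no `def`, no instance, no
notation, no `sorry`, default heartbeats); ★-only imports; lane `--supports stmt-HodgeConjecture-24833 --as helper` (count-neutral); pays NO row, states NO law.

THE MATHEMATICS (this seat's H-ROW DERIVATION v1 e4da7f0103cc4a29 §3: the «−1 − ψ₀(1)» of the BOUNDARY key `s_g = 2d − 2`).  For a fixed `δ` with `|δ| = |ϖ|^{2d−2}` the function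
`ψ(x) := ω(1 + δx)` on the fixed integers `x` is: constant on residue classes (`|x − x′| < 1 ⇒ |x − x′| ≤ |ϖ|²` for fixed scalars, so `δ(x − x′) ∈ 𝔭^{2d}`, ★ toolkit §3); ADDITIVE
(`(1+δx)(1+δy) = (1+δ(x+y))·(1 + O(δ²))`, `δ² ∈ 𝔭^{4d−4} ⊆ 𝔭^{2d−1}` as `d ≥ 2`); trivial on `𝔭`; and NON-trivial: ★ toolkit §2 gives a fixed non-norm `c′ ≡ 1 (𝔭^{2d−2})`, and
`c₀ := (c′ − 1)∕δ` is a fixed integer with `ψ(c₀) = ω(c′) = −1`.  Let `R` be a complete irredundant system of representatives of the fixed units modulo `𝔭^ρ` (`ρ ≥ 1`, `#R =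
(q−1)q^{⌈ρ∕2⌉−1}`), `R_bad = {g ∈ R : |1+g| < 1}` (★ (B): `#R_bad = q^{⌈ρ∕2⌉−1}`), `R_adm = R ∖ R_bad`.  Then `R₊ := R ⊔ (1 + R_bad)` is a complete irredundant system of the fixed
INTEGERS modulo `𝔭^ρ`, the translation `x ↦ rep(x + c₀)` permutes `R₊` and flips `ψ`, so `Σ_{R₊} ψ = 0`; and `ψ ≡ 1` on `1 + R_bad ⊆ 𝔭`, `ψ ≡ ψ(−1) = ω(1 − δ)` on `R_bad`.  Hence
**`Σ_{g ∈ R_adm} ω(1 + δg) = −q^{⌈ρ∕2⌉−1}·(1 + ω(1 − δ))`** (`∈ {0, −2q^{⌈ρ∕2⌉−1}}`; at `q = 2` both sides are `0`).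
* §0 the `ψ`-letters (★ `v_le_varpi_sq_of_fixed_of_lt_one`: a fixed scalar of `𝓂` lies in `𝓂²`); §1 the full integer system `R₊` and the additive flip; §2 HEAD `finsum_normSign_one_add_mul_admissible_eq`
  (finsum∕ℚ currency of ★ κH-B1); §3 the same sum over ANY complete irredundant admissible system `S` (Finset∕ℤ currency of ★ κH (B1a) §2), by embedding `S` into the full system
  `S ⊔ R₀_bad`.
HONEST LABEL.  Count-neutral (`--supports`); the boundary H rows (FILE 4c ff.), the shallow keys, `hRest`, (T3), (β-BAL), (β), T₊ stay OPEN; `HC_CM` is proved only modulo the 7 printed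
citations (2 remaining named inputs: hLiu418 = `stmt-HodgeConjecture-24832`, h413 = `stmt-HodgeConjecture-24833`) until rung 0 closes.

## References
* [Serre1979] J.-P. Serre, *Local Fields*, GTM 67 (1979), Ch. V §3 Prop. 5, Cor. 2–3 pp. 84–86; Ch. XV §2 (the conductor; `U^{(n)}∕U^{(n+1)} ≅ k` additively, Ch. IV §2 Prop. 6).
* [Kottwitz1986BaseChangeUnits] R. E. Kottwitz, *Base change for unit elements of Hecke algebras*, Compositio Math. 60 (1986), §1 pp. 240–241.
* [Rogawski1990] J. D. Rogawski, *Automorphic Representations of Unitary Groups in Three Variables*, Ann. of Math. Stud. 123 (1990), §4.10 p. 58.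
-/

set_option autoImplicit false

noncomputable section

namespace Summit.HodgeConjecture.HodgeConjecture.Cruxes.H413.F0P3cDyRamAdmissibleAdditiveCharacterSum

open WithZero Matrix
open Literature.NumberTheory.Automorphic.UnitaryThreeFourFrame
open Literature.NumberTheory.LocalFields.WildQuadraticDatum
open Summit.HodgeConjecture.HodgeConjecture.Cruxes.H413.F0P3cDyRamDiagonalKappaCoreHangingCharacterMaps (v_add_eq_one_of_lt)
open Summit.HodgeConjecture.HodgeConjecture.Cruxes.H413.F0P3cDyRamDiagonalCoreHangingClasses (ncard_bad_representatives_eq)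
open Summit.HodgeConjecture.HodgeConjecture.Cruxes.H413.F0P3cDyRamDiagonalKappaCoreHangingClass (two_le_d_of_v_two_lt_one)
open scoped Valued

variable {K : Type} [Field K] [Valued K ℤᵐ⁰]

/-! ## §0 The `ψ`-letters of `ψ(x) = ω(1 + δx)`, `|δ| ≤ |ϖ|^{2d−2}`, on the fixed integers (`|2| < 1`, so `d ≥ 2`) -/

section Psi

variable {σ : K →+* K} {ϖ : K} {d t : ℕ}

/-- `|1 + δx| = 1` and `σ(1 + δx) = 1 + δx` for a fixed integer `x` (`|δ| ≤ |ϖ|^{2d−2}`, `d ≥ 2`). [cite: Serre1979, Ch. XV §2] -/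
theorem v_one_add_mul_eq_one (hD : IsRamifiedQuadraticDatum σ ϖ d t) (h2 : Valued.v (2 : K) < 1) {δ : K} (hδ : Valued.v δ ≤ Valued.v ϖ ^ (2 * d - 2))
    {x : K} (hx : Valued.v x ≤ 1) : Valued.v (δ * x) < 1 ∧ Valued.v (1 + δ * x) = 1 := by
  have hϖ := hD.2.2.1
  have hd2 := two_le_d_of_v_two_lt_one hD h2
  have hϖ1 : Valued.v ϖ < 1 := by rw [hϖ, ← exp_zero, exp_lt_exp]; norm_num
  have hδ1 : Valued.v (δ * x) < 1 := by
    rw [map_mul]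
    refine (mul_le_mul' hδ hx).trans_lt ?_
    rw [mul_one]; exact pow_lt_one₀ zero_le hϖ1 (by omega)
  exact ⟨hδ1, v_add_eq_one_of_lt (map_one _) hδ1⟩

/-- **`ψ` IS CONSTANT ON RESIDUE CLASSES**: fixed integers `x, x′` with `|x − x′| < 1` have `ω(1 + δx′) = ω(1 + δx)` (`|δ| ≤ |ϖ|^{2d−2}`; `δ(x − x′) ∈ 𝔭^{2d}`, ★ toolkit §3).
[cite: Serre1979, Ch. XV §2] -/
theorem normSign_one_add_mul_eq_of_near [CompleteSpace K] (hD : IsRamifiedQuadraticDatum σ ϖ d t) (h2 : Valued.v (2 : K) < 1) {δ : K} (hσδ : σ δ = δ)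
    (hδ : Valued.v δ ≤ Valued.v ϖ ^ (2 * d - 2)) {x x' : K} (hσx : σ x = x) (hσx' : σ x' = x') (hx : Valued.v x ≤ 1) (hxx' : Valued.v (x - x') < 1) :
    normSign σ (1 + δ * x') = normSign σ (1 + δ * x) := by
  have hϖ := hD.2.2.1
  have hϖ1 : Valued.v ϖ < 1 := by rw [hϖ, ← exp_zero, exp_lt_exp]; norm_num
  have hv1 := (v_one_add_mul_eq_one hD h2 hδ hx).2
  have hsq := v_le_varpi_sq_of_fixed_of_lt_one hD (by rw [map_sub, hσx, hσx']) hxx'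
  refine normSign_eq_of_near hD (by rw [map_add, map_one, map_mul, hσδ, hσx]) (by rw [map_add, map_one, map_mul, hσδ, hσx']) hv1 (n := 2 * d - 1) le_rfl ?_
  rw [show 1 + δ * x - (1 + δ * x') = δ * (x - x') by ring, map_mul]
  refine (mul_le_mul' hδ hsq).trans ?_
  rw [← pow_add]
  exact pow_le_pow_right_of_le_one' hϖ1.le (by omega)

/-- **`ψ` IS ADDITIVE**: `ω(1 + δ(x + y)) = ω(1 + δx)·ω(1 + δy)` for fixed integers `x, y` (`|δ| ≤ |ϖ|^{2d−2}`, `d ≥ 2`: `(1+δx)(1+δy) = (1+δ(x+y))·u` with `|u − 1| ≤ |δ|² ≤ |ϖ|^{2d−1}`,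
★ toolkit §3–§4). [cite: Serre1979, Ch. XV §2; Ch. V §3 Cor. 3] -/
theorem normSign_one_add_mul_add [CompleteSpace K] [Finite 𝓀[K]] (hD : IsRamifiedQuadraticDatum σ ϖ d t) (h2 : Valued.v (2 : K) < 1) {δ : K} (hσδ : σ δ = δ)
    (hδ : Valued.v δ ≤ Valued.v ϖ ^ (2 * d - 2)) {x y : K} (hσx : σ x = x) (hσy : σ y = y) (hx : Valued.v x ≤ 1) (hy : Valued.v y ≤ 1) :
    normSign σ (1 + δ * (x + y)) = normSign σ (1 + δ * x) * normSign σ (1 + δ * y) := by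
  have hϖ := hD.2.2.1
  have hd2 := two_le_d_of_v_two_lt_one hD h2
  have hϖ1 : Valued.v ϖ < 1 := by rw [hϖ, ← exp_zero, exp_lt_exp]; norm_num
  obtain ⟨-, hvx⟩ := v_one_add_mul_eq_one hD h2 hδ hx
  obtain ⟨-, hvy⟩ := v_one_add_mul_eq_one hD h2 hδ hy
  obtain ⟨-, hvP⟩ := v_one_add_mul_eq_one hD h2 hδ ((Valuation.map_add _ _ _).trans (max_le hx hy))
  have hX0 : 1 + δ * x ≠ 0 := fun h => by rw [h, map_zero] at hvx; exact zero_ne_one hvx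
  have hY0 : 1 + δ * y ≠ 0 := fun h => by rw [h, map_zero] at hvy; exact zero_ne_one hvy
  have hP0 : 1 + δ * (x + y) ≠ 0 := fun h => by rw [h, map_zero] at hvP; exact zero_ne_one hvP
  have hσX : σ (1 + δ * x) = 1 + δ * x := by rw [map_add, map_one, map_mul, hσδ, hσx]
  have hσY : σ (1 + δ * y) = 1 + δ * y := by rw [map_add, map_one, map_mul, hσδ, hσy]
  have hσP : σ (1 + δ * (x + y)) = 1 + δ * (x + y) := by rw [map_add, map_one, map_mul, map_add, hσδ, hσx, hσy]
  -- `u := (1+δx)(1+δy) ∕ (1+δ(x+y))`, `u − 1 = δ²xy ∕ (1+δ(x+y))`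
  obtain ⟨u, hu⟩ : ∃ u : K, u = (1 + δ * x) * (1 + δ * y) / (1 + δ * (x + y)) := ⟨_, rfl⟩
  have hσu : σ u = u := by rw [hu, map_div₀, map_mul, hσX, hσY, hσP]
  have hfac : (1 + δ * x) * (1 + δ * y) = (1 + δ * (x + y)) * u := by rw [hu, mul_div_cancel₀ _ hP0]
  have hu1 : Valued.v (u - 1) ≤ Valued.v ϖ ^ (2 * d - 1) := by
    have e : u - 1 = δ * δ * (x * y) / (1 + δ * (x + y)) := by
      rw [hu, div_sub_one hP0]; congr 1; ring
    rw [e, map_div₀, hvP, div_one, map_mul, map_mul, map_mul]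
    calc Valued.v δ * Valued.v δ * (Valued.v x * Valued.v y)
        ≤ Valued.v ϖ ^ (2 * d - 2) * Valued.v ϖ ^ (2 * d - 2) * (1 * 1) :=
          mul_le_mul' (mul_le_mul' hδ hδ) (mul_le_mul' hx hy)
      _ = Valued.v ϖ ^ (2 * d - 2 + (2 * d - 2)) := by rw [mul_one, mul_one, pow_add]
      _ ≤ Valued.v ϖ ^ (2 * d - 1) := pow_le_pow_right_of_le_one' hϖ1.le (by omega)
  rw [← normSign_mul_of_fixed hD hσX hσY hX0 hY0, hfac, normSign_mul_eq_of_fixed_of_v_sub_one_le hD _ hσu le_rfl hu1]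

/-- **`ψ ≡ 1` ON `𝔭`**: a fixed `x` with `|x| < 1` has `ω(1 + δx) = 1` (`|x| ≤ |ϖ|²`, so `δx ∈ 𝔭^{2d}`). [cite: Serre1979, Ch. XV §2] -/
theorem normSign_one_add_mul_eq_one_of_lt [CompleteSpace K] (hD : IsRamifiedQuadraticDatum σ ϖ d t) {δ : K} (hσδ : σ δ = δ)
    (hδ : Valued.v δ ≤ Valued.v ϖ ^ (2 * d - 2)) {x : K} (hσx : σ x = x) (hx : Valued.v x < 1) : normSign σ (1 + δ * x) = 1 := by
  have hϖ := hD.2.2.1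
  have hϖ1 : Valued.v ϖ < 1 := by rw [hϖ, ← exp_zero, exp_lt_exp]; norm_num
  have hsq := v_le_varpi_sq_of_fixed_of_lt_one hD hσx hx
  refine normSign_eq_one_of_fixed_of_v_sub_one_le hD (by rw [map_add, map_one, map_mul, hσδ, hσx]) (n := 2 * d - 1) le_rfl ?_
  rw [add_sub_cancel_left, map_mul]
  refine (mul_le_mul' hδ hsq).trans ?_
  rw [← pow_add]
  exact pow_le_pow_right_of_le_one' hϖ1.le (by omega)

/-- **`ψ` IS NON-TRIVIAL AT THE BREAK**: for `|δ| = |ϖ|^{2d−2}` (`|2| < 1`) there is a fixed integer `c₀` with `ω(1 + δc₀) = −1` (★ toolkit §2: a fixed non-norm `c′` with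
`|c′ − 1| ≤ |ϖ|^{2d−2}`; `c₀ = (c′ − 1)∕δ`). [cite: Serre1979, Ch. V §3 Prop. 5, Cor. 2–3 pp. 84–86; Ch. XV §2] -/
theorem exists_normSign_one_add_mul_eq_neg_one [Finite 𝓀[K]] (hD : IsRamifiedQuadraticDatum σ ϖ d t) (h2 : Valued.v (2 : K) < 1) {δ : K} (hσδ : σ δ = δ)
    (hδ : Valued.v δ = Valued.v ϖ ^ (2 * d - 2)) : ∃ c₀ : K, σ c₀ = c₀ ∧ Valued.v c₀ ≤ 1 ∧ normSign σ (1 + δ * c₀) = -1 := by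
  have hϖ := hD.2.2.1
  have hd1 := hD.2.2.2.2.2.1
  obtain ⟨c', hσc', -, hc'd, hc'n⟩ := exists_fixed_unit_not_norm_v_sub_one_le hD h2
  have hϖ0 : Valued.v ϖ ≠ 0 := by rw [hϖ]; exact exp_ne_zero
  have hδ0 : δ ≠ 0 := fun h => by
    rw [h, map_zero] at hδ; exact pow_ne_zero _ hϖ0 hδ.symm
  have hvδ : 0 < Valued.v δ := (Valuation.pos_iff _).2 hδ0
  refine ⟨(c' - 1) / δ, by rw [map_div₀, map_sub, map_one, hσc', hσδ], ?_, ?_⟩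
  · rw [map_div₀, div_le_one₀ hvδ, hδ, v_varpi_pow hϖ]
    refine hc'd.trans (le_of_eq ?_)
    congr 1; omega
  · rw [mul_div_cancel₀ _ hδ0, add_sub_cancel]
    exact normSign_of_not_isNorm σ hc'n

end Psi

/-! ## §1 The full integer system `R₊ = R ⊔ (1 + R_bad)` and the additive flip `Σ_{R₊} ψ = 0` -/

section Flip

variable {σ : K →+* K} {ϖ : K} {d t : ℕ}

/-- **THE ADDITIVE FLIP**: for a finite set `P` of fixed integers which is a complete irredundant system of representatives of ALL fixed integers modulo `𝔭^ρ` (`ρ ≥ 1`) and `|δ| = |ϖ|^{2d−2}`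
(`|2| < 1`): `Σ_{x ∈ P} ω(1 + δx) = 0` — the translation `x ↦ rep(x + c₀)` by the §0 witness `c₀` (`ψ(c₀) = −1`) permutes `P` and flips `ψ` (★ toolkit §5 pattern, additive).
[cite: Serre1979, Ch. XV §2; Ch. IV §2 Prop. 6] -/
theorem sum_normSign_one_add_mul_repr_integers_eq_zero [CompleteSpace K] [Finite 𝓀[K]] (hD : IsRamifiedQuadraticDatum σ ϖ d t) (h2 : Valued.v (2 : K) < 1)
    {ρ : ℕ} (hρ : 1 ≤ ρ) {δ : K} (hσδ : σ δ = δ) (hδ : Valued.v δ = Valued.v ϖ ^ (2 * d - 2)) (P : Finset K)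
    (hP1 : ∀ x ∈ P, σ x = x ∧ Valued.v x ≤ 1) (hP2 : ∀ y : K, σ y = y → Valued.v y ≤ 1 → ∃ x ∈ P, Valued.v (y - x) ≤ Valued.v ϖ ^ ρ)
    (hP3 : ∀ x ∈ P, ∀ x' ∈ P, Valued.v (x - x') ≤ Valued.v ϖ ^ ρ → x = x') :
    ∑ x ∈ P, normSign σ (1 + δ * x) = 0 := by
  classical
  have hϖ := hD.2.2.1
  have hϖ1 : Valued.v ϖ < 1 := by rw [hϖ, ← exp_zero, exp_lt_exp]; norm_num
  have hpρ : Valued.v ϖ ^ ρ < 1 := pow_lt_one₀ zero_le hϖ1 (by omega)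
  obtain ⟨c₀, hσc₀, hc₀, hψc₀⟩ := exists_normSign_one_add_mul_eq_neg_one hD h2 hσδ hδ
  -- the representative map `φ x := rep(x + c₀)`
  have hrep : ∀ x ∈ P, ∃ x' ∈ P, Valued.v (x + c₀ - x') ≤ Valued.v ϖ ^ ρ := fun x hx =>
    hP2 (x + c₀) (by rw [map_add, (hP1 x hx).1, hσc₀]) ((Valuation.map_add _ _ _).trans (max_le (hP1 x hx).2 hc₀))
  choose! φ hφP hφ using hrep
  -- `ψ(φ x) = −ψ(x)`
  have hflip : ∀ x ∈ P, normSign σ (1 + δ * φ x) = -normSign σ (1 + δ * x) := by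
    intro x hx
    obtain ⟨hσx, hvx⟩ := hP1 x hx
    obtain ⟨hσφ, -⟩ := hP1 _ (hφP x hx)
    rw [normSign_one_add_mul_eq_of_near hD h2 hσδ hδ.le (x := x + c₀) (by rw [map_add, hσx, hσc₀]) hσφ
        ((Valuation.map_add _ _ _).trans (max_le hvx hc₀)) ((hφ x hx).trans_lt hpρ),
      normSign_one_add_mul_add hD h2 hσδ hδ.le hσx hσc₀ hvx hc₀, hψc₀, mul_neg_one]
  -- `φ` maps `P` to `P` injectively, hence bijectively
  have hinj : ∀ x₁ ∈ P, ∀ x₂ ∈ P, φ x₁ = φ x₂ → x₁ = x₂ := by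
    intro x₁ hx₁ x₂ hx₂ heq
    apply hP3 x₁ hx₁ x₂ hx₂
    have h1 := hφ x₁ hx₁; have h2' := hφ x₂ hx₂
    rw [heq] at h1
    rw [show x₁ - x₂ = (x₁ + c₀ - φ x₂) - (x₂ + c₀ - φ x₂) by ring]
    exact (Valuation.map_sub _ _ _).trans (max_le h1 h2')
  have hsum : ∑ x ∈ P, normSign σ (1 + δ * φ x) = ∑ x ∈ P, normSign σ (1 + δ * x) :=
    Finset.sum_bij (fun x _ => φ x) (fun x hx => hφP x hx) (fun x₁ hx₁ x₂ hx₂ h => hinj x₁ hx₁ x₂ hx₂ h)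
      (fun y hy => by
        have himg : (P.image φ) = P := Finset.eq_of_subset_of_card_le (Finset.image_subset_iff.2 fun x hx => hφP x hx)
          (by rw [Finset.card_image_of_injOn (fun x₁ hx₁ x₂ hx₂ h => hinj x₁ hx₁ x₂ hx₂ h)])
        have hy' : y ∈ P.image φ := by rw [himg]; exact hy
        obtain ⟨x, hx, hxy⟩ := Finset.mem_image.1 hy'
        exact ⟨x, hx, hxy⟩)
      (fun _ _ => rfl)
  have hneg : ∑ x ∈ P, normSign σ (1 + δ * φ x) = -∑ x ∈ P, normSign σ (1 + δ * x) := by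
    rw [← Finset.sum_neg_distrib]; exact Finset.sum_congr rfl hflip
  have h2' : (2 : ℤ) * ∑ x ∈ P, normSign σ (1 + δ * x) = 0 := by linarith
  simpa using h2'

end Flip

/-! ## §2 HEAD — the additive character sum over the admissible classes -/

/-- **`Σ_{g ∈ R, |1+g| = 1} ω(1 + δg) = −q^{⌈ρ∕2⌉−1}·(1 + ω(1 − δ))`** for `|δ| = |ϖ|^{2d−2}` (`δ` fixed), a ramified datum with `|2| < 1` on a complete field with finite residue field
`q = #𝓀`, and a complete irredundant system `R` of representatives of the fixed units modulo `𝔭^ρ` (`ρ ≥ 1`; ★ `exists_fixed_class_representatives … ρ 0` letters) — §1 on `R₊ = R ⊔ (1 + R_bad)`, minus the classes `0̄` (`ψ = 1`, §0) and `−1̄` (`ψ = ω(1−δ)`, §0), `#R_bad = q^{⌈ρ∕2⌉−1}` (★ (B)).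
[cite: Serre1979, Ch. XV §2; Ch. IV §2 Prop. 6] [cite: Kottwitz1986BaseChangeUnits, §1 pp. 240–241] -/
theorem finsum_normSign_one_add_mul_admissible_eq [CompleteSpace K] [Finite 𝓀[K]] {σ : K →+* K} {ϖ : K} {d t : ℕ}
    (hD : IsRamifiedQuadraticDatum σ ϖ d t) (h2 : Valued.v (2 : K) < 1) {ρ : ℕ} (hρ : 1 ≤ ρ)
    {R : Set K} (hRfin : R.Finite)
    (hR1 : ∀ g ∈ R, σ g = g ∧ Valued.v g = 1) (hR2 : ∀ f : K, σ f = f → Valued.v f = 1 → ∃ g ∈ R, Valued.v (f - g) ≤ Valued.v ϖ ^ ρ)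
    (hR3 : ∀ g ∈ R, ∀ g' ∈ R, Valued.v (g - g') ≤ Valued.v ϖ ^ ρ → g = g')
    {δ : K} (hσδ : σ δ = δ) (hδ : Valued.v δ = Valued.v ϖ ^ (2 * d - 2)) :
    ∑ᶠ g ∈ {g : K | g ∈ R ∧ Valued.v (1 + g) = 1}, (normSign σ (1 + δ * g) : ℚ) =
      -((Nat.card 𝓀[K] : ℚ) ^ ((ρ + 1) / 2 - 1)) * (1 + normSign σ (1 - δ)) := by
  classical
  obtain ⟨hσ, hvσ, hϖ, hfix, hd, hd1, -⟩ := id hD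
  have hϖ1 : Valued.v ϖ < 1 := by rw [hϖ, ← exp_zero, exp_lt_exp]; norm_num
  have hpρ : Valued.v ϖ ^ ρ < 1 := pow_lt_one₀ zero_le hϖ1 (by omega)
  -- the Finsets `RF ⊇ S, B₁` and `B₀ = 1 + B₁`
  set RF : Finset K := hRfin.toFinset with hRFdef
  have hmemRF : ∀ g, g ∈ RF ↔ g ∈ R := fun g => Set.Finite.mem_toFinset hRfin
  set S : Finset K := RF.filter (fun g => Valued.v (1 + g) = 1) with hSdef
  set B₁ : Finset K := RF.filter (fun g => ¬ Valued.v (1 + g) = 1) with hB₁def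
  set B₀ : Finset K := B₁.image (fun g => 1 + g) with hB₀def
  have h1le : ∀ g ∈ R, Valued.v (1 + g) ≤ 1 := fun g hg =>
    (Valuation.map_add _ _ _).trans (max_le (le_of_eq (map_one _)) (le_of_eq (hR1 g hg).2))
  have hmemS : ∀ g, g ∈ S ↔ g ∈ R ∧ Valued.v (1 + g) = 1 := fun g => by rw [hSdef, Finset.mem_filter, hmemRF]
  have hmemB₁ : ∀ g, g ∈ B₁ ↔ g ∈ R ∧ Valued.v (1 + g) < 1 := fun g => by
    rw [hB₁def, Finset.mem_filter, hmemRF]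
    exact ⟨fun ⟨h1, h2⟩ => ⟨h1, lt_of_le_of_ne (h1le g h1) h2⟩, fun ⟨h1, h2⟩ => ⟨h1, ne_of_lt h2⟩⟩
  have hmemB₀ : ∀ x, x ∈ B₀ ↔ ∃ g, (g ∈ R ∧ Valued.v (1 + g) < 1) ∧ 1 + g = x := fun x => by
    rw [hB₀def, Finset.mem_image]
    exact ⟨fun ⟨g, hg, e⟩ => ⟨g, (hmemB₁ g).1 hg, e⟩, fun ⟨g, hg, e⟩ => ⟨g, (hmemB₁ g).2 hg, e⟩⟩
  -- `#B₁ = #B₀ = q^{⌈ρ∕2⌉−1}` (★ (B))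
  have hB₁card : B₁.card = Nat.card 𝓀[K] ^ ((ρ + 1) / 2 - 1) := by
    have hset : ({g ∈ R | Valued.v (1 + g) < 1} : Set K) = ↑B₁ := by
      ext g; rw [Finset.mem_coe, hmemB₁]; rfl
    rw [← ncard_bad_representatives_eq hσ hvσ hfix hϖ hd hρ hRfin hR1 hR2 hR3, hset, Set.ncard_coe_finset]
  have hB₀card : B₀.card = B₁.card := Finset.card_image_of_injective _ (add_right_injective (1 : K))
  -- `RF = S ⊔ B₁`, `RF` and `B₀` are disjoint (units versus non-units)
  have hsplit : ∑ g ∈ RF, normSign σ (1 + δ * g) = ∑ g ∈ S, normSign σ (1 + δ * g) + ∑ g ∈ B₁, normSign σ (1 + δ * g) := by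
    rw [hSdef, hB₁def]; exact (Finset.sum_filter_add_sum_filter_not RF _ _).symm
  have hdisj : Disjoint RF B₀ := by
    rw [Finset.disjoint_left]
    intro x hx hx0
    obtain ⟨g, ⟨-, hg⟩, rfl⟩ := (hmemB₀ _).1 hx0
    have := (hR1 _ ((hmemRF _).1 hx)).2
    rw [this] at hg
    exact lt_irrefl _ hg
  -- `R₊ = RF ∪ B₀` is a complete irredundant system of the fixed integers
  have hP1 : ∀ x ∈ RF ∪ B₀, σ x = x ∧ Valued.v x ≤ 1 := by
    intro x hx
    rcases Finset.mem_union.1 hx with hx | hx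
    · obtain ⟨hσx, hvx⟩ := hR1 x ((hmemRF x).1 hx); exact ⟨hσx, hvx.le⟩
    · obtain ⟨g, ⟨hgR, hg⟩, rfl⟩ := (hmemB₀ x).1 hx
      exact ⟨by rw [map_add, map_one, (hR1 g hgR).1], hg.le⟩
  have hP2 : ∀ y : K, σ y = y → Valued.v y ≤ 1 → ∃ x ∈ RF ∪ B₀, Valued.v (y - x) ≤ Valued.v ϖ ^ ρ := by
    intro y hσy hy
    rcases hy.lt_or_eq with hlt | heq
    · -- `y ∈ 𝓂`: `y − 1` is a fixed unit, represented by some `g ∈ R_bad`; take `x = 1 + g`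
      have hy1 : Valued.v (y - 1) = 1 := by
        rw [show y - 1 = -1 + y by ring]; exact v_add_eq_one_of_lt (by rw [Valuation.map_neg, map_one]) hlt
      obtain ⟨g, hgR, hfg⟩ := hR2 (y - 1) (by rw [map_sub, map_one, hσy]) hy1
      have hgbad : Valued.v (1 + g) < 1 := by
        rw [show 1 + g = y + -(y - 1 - g) by ring]
        refine (Valuation.map_add _ _ _).trans_lt (max_lt hlt ?_)
        rw [Valuation.map_neg]; exact hfg.trans_lt hpρ
      refine ⟨1 + g, Finset.mem_union_right _ ((hmemB₀ _).2 ⟨g, ⟨hgR, hgbad⟩, rfl⟩), ?_⟩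
      rw [show y - (1 + g) = y - 1 - g by ring]; exact hfg
    · obtain ⟨g, hgR, hfg⟩ := hR2 y hσy heq
      exact ⟨g, Finset.mem_union_left _ ((hmemRF g).2 hgR), hfg⟩
  have hP3 : ∀ x ∈ RF ∪ B₀, ∀ x' ∈ RF ∪ B₀, Valued.v (x - x') ≤ Valued.v ϖ ^ ρ → x = x' := by
    intro x hx x' hx' hle
    -- a unit and a non-unit are at distance `1 > |ϖ|^ρ`
    have hfar : ∀ a b : K, Valued.v a = 1 → Valued.v b < 1 → ¬ Valued.v (a - b) ≤ Valued.v ϖ ^ ρ := by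
      intro a b ha hb h
      have : Valued.v (a - b) = 1 := by rw [sub_eq_add_neg]; exact v_add_eq_one_of_lt ha (by rw [Valuation.map_neg]; exact hb)
      rw [this] at h; exact absurd h (not_le.2 hpρ)
    rcases Finset.mem_union.1 hx with hx | hx <;> rcases Finset.mem_union.1 hx' with hx' | hx'
    · exact hR3 x ((hmemRF x).1 hx) x' ((hmemRF x').1 hx') hle
    · obtain ⟨g, ⟨-, hg⟩, rfl⟩ := (hmemB₀ x').1 hx'
      exact absurd hle (hfar _ _ (hR1 x ((hmemRF x).1 hx)).2 hg)
    · obtain ⟨g, ⟨-, hg⟩, rfl⟩ := (hmemB₀ x).1 hx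
      rw [Valuation.map_sub_swap] at hle
      exact absurd hle (hfar _ _ (hR1 x' ((hmemRF x').1 hx')).2 hg)
    · obtain ⟨g, ⟨hgR, -⟩, rfl⟩ := (hmemB₀ x).1 hx
      obtain ⟨g', ⟨hg'R, -⟩, rfl⟩ := (hmemB₀ x').1 hx'
      rw [show (1 : K) + g - (1 + g') = g - g' by ring] at hle
      rw [hR3 g hgR g' hg'R hle]
  -- §1: `Σ_{R₊} ψ = 0`
  have hflip := sum_normSign_one_add_mul_repr_integers_eq_zero hD h2 hρ hσδ hδ (RF ∪ B₀) hP1 hP2 hP3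
  rw [Finset.sum_union hdisj, hsplit] at hflip
  -- `ψ ≡ 1` on `B₀ ⊆ 𝓂`, `ψ ≡ ω(1 − δ)` on `B₁` (the residue class of `−1`)
  have hsumB₀ : ∑ x ∈ B₀, normSign σ (1 + δ * x) = (B₁.card : ℤ) := by
    rw [← hB₀card, ← mul_one (B₀.card : ℤ), ← nsmul_eq_mul, ← Finset.sum_const]
    refine Finset.sum_congr rfl fun x hx => ?_
    obtain ⟨g, ⟨hgR, hg⟩, rfl⟩ := (hmemB₀ x).1 hx
    exact normSign_one_add_mul_eq_one_of_lt hD hσδ hδ.le (by rw [map_add, map_one, (hR1 g hgR).1]) hg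
  have hsumB₁ : ∑ g ∈ B₁, normSign σ (1 + δ * g) = (B₁.card : ℤ) * normSign σ (1 - δ) := by
    rw [← nsmul_eq_mul, ← Finset.sum_const]
    refine Finset.sum_congr rfl fun g hg => ?_
    obtain ⟨hgR, hbad⟩ := (hmemB₁ g).1 hg
    rw [show (1 : K) - δ = 1 + δ * (-1) by ring]
    exact normSign_one_add_mul_eq_of_near hD h2 hσδ hδ.le (x := -1) (by rw [map_neg, map_one]) (hR1 g hgR).1 (by rw [Valuation.map_neg, map_one])
      (by rw [show (-1 : K) - g = -(1 + g) by ring, Valuation.map_neg]; exact hbad)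
  rw [hsumB₀, hsumB₁, hB₁card] at hflip
  -- the admissible sum in `ℤ`
  have hS : ∑ g ∈ S, normSign σ (1 + δ * g) = -((Nat.card 𝓀[K] : ℤ) ^ ((ρ + 1) / 2 - 1)) * (1 + normSign σ (1 - δ)) := by
    push_cast at hflip ⊢; linarith
  -- pass to the finsum in `ℚ`
  have hAfin : {g : K | g ∈ R ∧ Valued.v (1 + g) = 1}.Finite := hRfin.subset fun g hg => hg.1
  rw [finsum_mem_eq_finite_toFinset_sum _ hAfin]
  have hAS : hAfin.toFinset = S := by
    ext g; rw [Set.Finite.mem_toFinset, hmemS]; rfl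
  rw [hAS, ← Int.cast_sum, hS]
  push_cast
  ring

/-! ## §3 The same sum over any complete irredundant admissible system -/

/-- **`Σ_{g ∈ S} ω(1 + δg) = −q^{⌈ρ∕2⌉−1}·(1 + ω(1 − δ))`** over ANY complete irredundant system `S` of representatives modulo `𝔭^ρ` (`ρ ≥ 1`) of the admissible fixed units `{|g| = |1+g| = 1}`
(`|δ| = |ϖ|^{2d−2}`, `δ` fixed; `|2| < 1`) — §2 applied to the full system `S ⊔ R₀_bad` (`R₀` any full system, ★ (iv-c)), whose admissible part is `S`.  The currency of ★ κH (B1a) §2, so that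
the ★ transports (`g ↦ −(1+g)`, `g ↦ −g∕(1+g)`, FILE 4b's `g ↦ g + c`, `g ↦ c∕g`) apply before summing. [cite: Serre1979, Ch. XV §2; Ch. IV §2 Prop. 6] [cite: Kottwitz1986BaseChangeUnits, §1 pp. 240–241] -/
theorem sum_normSign_one_add_mul_eq_of_repr_admissible [CompleteSpace K] [Finite 𝓀[K]] {σ : K →+* K} {ϖ : K} {d t : ℕ}
    (hD : IsRamifiedQuadraticDatum σ ϖ d t) (h2 : Valued.v (2 : K) < 1) {ρ : ℕ} (hρ : 1 ≤ ρ) {δ : K} (hσδ : σ δ = δ) (hδ : Valued.v δ = Valued.v ϖ ^ (2 * d - 2))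
    (S : Finset K) (hS1 : ∀ g ∈ S, σ g = g ∧ Valued.v g = 1 ∧ Valued.v (1 + g) = 1)
    (hS2 : ∀ f : K, σ f = f → Valued.v f = 1 → Valued.v (1 + f) = 1 → ∃ g ∈ S, Valued.v (f - g) ≤ Valued.v ϖ ^ ρ)
    (hS3 : ∀ g ∈ S, ∀ g' ∈ S, Valued.v (g - g') ≤ Valued.v ϖ ^ ρ → g = g') :
    ∑ g ∈ S, normSign σ (1 + δ * g) = -((Nat.card 𝓀[K] : ℤ) ^ ((ρ + 1) / 2 - 1)) * (1 + normSign σ (1 - δ)) := by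
  classical
  obtain ⟨hσ, hvσ, hϖ, hfix, hd, hd1, -⟩ := id hD
  have hϖ1 : Valued.v ϖ < 1 := by rw [hϖ, ← exp_zero, exp_lt_exp]; norm_num
  have hpρ : Valued.v ϖ ^ ρ < 1 := pow_lt_one₀ zero_le hϖ1 (by omega)
  -- a full system `R₀` and its bad part `B`; the full system `R = S ⊔ B`
  obtain ⟨R₀, hR₀fin, -, hR₀1, hR₀2, hR₀3⟩ := F0P3cDyRamDiagonalGluedClassRepresentatives.exists_fixed_class_representatives hσ hvσ hfix hϖ hd ρ 0 hρ
  simp only [Nat.mul_zero, pow_zero, Nat.add_zero] at hR₀1 hR₀2 hR₀3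
  obtain ⟨R, hR⟩ : ∃ R : Set K, R = ↑S ∪ {g : K | g ∈ R₀ ∧ Valued.v (1 + g) < 1} := ⟨_, rfl⟩
  have hmemR : ∀ g, g ∈ R ↔ g ∈ S ∨ (g ∈ R₀ ∧ Valued.v (1 + g) < 1) := fun g => by rw [hR]; rfl
  have hRfin : R.Finite := by rw [hR]; exact (Finset.finite_toSet S).union (hR₀fin.subset fun g hg => hg.1)
  have hR1 : ∀ g ∈ R, σ g = g ∧ Valued.v g = 1 := by
    intro g hg
    rcases (hmemR g).1 hg with hg | hg
    · exact ⟨(hS1 g hg).1, (hS1 g hg).2.1⟩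
    · exact hR₀1 g hg.1
  have hR2 : ∀ f : K, σ f = f → Valued.v f = 1 → ∃ g ∈ R, Valued.v (f - g) ≤ Valued.v ϖ ^ ρ := by
    intro f hσf hf
    have h1f : Valued.v (1 + f) ≤ 1 := (Valuation.map_add _ _ _).trans (max_le (le_of_eq (map_one _)) hf.le)
    rcases h1f.lt_or_eq with hlt | heq
    · obtain ⟨g, hg, hfg⟩ := hR₀2 f hσf hf
      have hgbad : Valued.v (1 + g) < 1 := by
        rw [show (1 : K) + g = (1 + f) + -(f - g) by ring]
        refine (Valuation.map_add _ _ _).trans_lt (max_lt hlt ?_)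
        rw [Valuation.map_neg]; exact hfg.trans_lt hpρ
      exact ⟨g, (hmemR g).2 (Or.inr ⟨hg, hgbad⟩), hfg⟩
    · obtain ⟨g, hg, hfg⟩ := hS2 f hσf hf heq
      exact ⟨g, (hmemR g).2 (Or.inl hg), hfg⟩
  have hfar : ∀ a b : K, Valued.v (1 + a) = 1 → Valued.v (1 + b) < 1 → ¬ Valued.v (a - b) ≤ Valued.v ϖ ^ ρ := by
    intro a b ha hb h
    have : Valued.v (a - b) = 1 := by
      rw [show a - b = (1 + a) + -(1 + b) by ring]; exact v_add_eq_one_of_lt ha (by rw [Valuation.map_neg]; exact hb)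
    rw [this] at h; exact absurd h (not_le.2 hpρ)
  have hR3 : ∀ g ∈ R, ∀ g' ∈ R, Valued.v (g - g') ≤ Valued.v ϖ ^ ρ → g = g' := by
    intro g hg g' hg' hle
    rcases (hmemR g).1 hg with hg | hg <;> rcases (hmemR g').1 hg' with hg' | hg'
    · exact hS3 g hg g' hg' hle
    · exact absurd hle (hfar g g' (hS1 g hg).2.2 hg'.2)
    · rw [Valuation.map_sub_swap] at hle; exact absurd hle (hfar g' g (hS1 g' hg').2.2 hg.2)
    · exact hR₀3 g hg.1 g' hg'.1 hle
  have hmain := finsum_normSign_one_add_mul_admissible_eq hD h2 hρ hRfin hR1 hR2 hR3 hσδ hδ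
  -- the admissible part of `R` is `S`
  have hset : {g : K | g ∈ R ∧ Valued.v (1 + g) = 1} = ↑S := by
    ext g
    rw [Finset.mem_coe]
    constructor
    · rintro ⟨hg, h1⟩
      rcases (hmemR g).1 hg with hg | hg
      · exact hg
      · exact absurd h1 (ne_of_lt hg.2)
    · intro hg; exact ⟨(hmemR g).2 (Or.inl hg), (hS1 g hg).2.2⟩
  rw [hset, finsum_mem_coe_finset] at hmain
  exact_mod_cast hmain

end Summit.HodgeConjecture.HodgeConjecture.Cruxes.H413.F0P3cDyRamAdmissibleAdditiveCharacterSum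

end
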